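import Literature.Computability.MetaComplexity.GraphOrderingPrincipleClosure
import Literature.Computability.MetaComplexity.GraphOrderingPrincipleSemantics
import HarnessLib

/-!
# Galesi–Lauria's degree lower bound for `GOP(G)` — the operator `L` and the proof of Theorem 1

Reproduction of Galesi–Lauria, ACM ToCL 2010, §3, Lemma 2 and Theorem 1: if `G` is an
`(r, c)`-vertex expander then `GOP(G)` has no PC refutation of degree `≤ cr/4`, over any field.
This DISCHARGES the named fact `GalesiLauria2010_PC_GOP_degree` of
`GraphOrderingPrincipleDegree.lean` (`GalesiLauria2010_PC_GOP_degree_holds`).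

Following GL10 (who follow Alekhnovich–Razborov): `L(t) := R_{T,M_{Sup(t)}}(t)` on monomials,
extended by linearity (`GOP.Lmon`, `GOP.L`; `R` = the residue of `PolynomialCalculusResidue*.lean`
relative to the common roots `GOP.locSol` of `T ∪ M_{Sup(t)}`, `Sup` = the support closure of
`GraphOrderingPrincipleClosure.lean`): `GOP.residue_locSol_eq_of_supp_subset` (Lemma 6, via
Lemma 5), `GOP.notMem_Vtx_of_mem_support_residue` (Lemma 7), `GOP.L_eq_zero_of_local` /
`GOP.L_monomial_add_single` / `GOP.L_one` (Lemma 2, Requirements 1–3), `GOP.L_eq_zero_of_derivable`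
(the induction of Theorem 1 over Krajíček's `PC.DerivableInDegree`: Boolean axioms explicit,
product by an arbitrary polynomial handled monomial by monomial and variable by variable),
`GOP.not_refutableInDegree_glGOP` and **`GalesiLauria2010_PC_GOP_degree_holds`**.

Source: N. Galesi, M. Lauria, *Optimality of size-degree tradeoffs for polynomial calculus*, ACM
ToCL 12(1) (2010), §3: Lemma 2 and Thm 1 p. 8–9, Lemmas 5–7 p. 11–12, proof of Lemma 2 p. 12–13
[GalesiLauria2010] (held copy `paper:doi-10-1145-1838552-1838556`).

Design notes.  (1) The displayed proof of Requirement 1 in GL10 (p. 12: "`L(p) = Σ βᵢ L(tᵢ) ≤_P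
Σ βᵢ R_T(tᵢ) = R_T(p) = 0`") compares sums of residues taken modulo different ideals; we instead
observe that every axiom usable in degree `≤ d ≤ cr/4` has `|Vertex(p)| ≤ cr/2`, so Lemma 6
applies to all its monomials at once with `I = Sup(Vertex(p))` and `L(p) = R_{T,M_I}(p) = 0`.
(2) The implicit hypotheses `1 ≤ r`, `0 < c` of the named fact are used exactly where GL10 use
them silently (`Sup(∅) = ∅`; every vertex has a neighbour; a usable `M_v` forces `r ≥ 4`).
(3) Colex on `Finset ℕ` is well founded (`Finset.orderIsoColex`), which feeds the residue files.
-/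

noncomputable section

namespace Literature.Computability.MetaComplexity

namespace GOP

open Finset MvPolynomial Literature.Computability.Complexity PCResidue

/-- Colex on finite sets of naturals is well founded (it is order-isomorphic to `ℕ`). [folklore] -/
theorem wellFoundedLT_colex_nat : WellFoundedLT (Colex (Finset ℕ)) :=
  Finset.orderIsoColex.symm.toOrderEmbedding.wellFoundedLT

-- A `Prop`-valued instance (`WellFoundedLT = IsWellFounded`), absent from Mathlib for this type and
-- proof-irrelevant, so it cannot override or conflict with any library instance; local to this file.
attribute [local instance] wellFoundedLT_colex_nat

variable {n : ℕ} (G : SimpleGraph (Fin n)) [DecidableRel G.Adj] (r : ℕ) {K : Type*} [Field K]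

/-! ### The operator `L` -/

variable (K) in
/-- `L` on a monomial: `L(t) := R_{T, M_{Sup(t)}}(t)`, the residue of `t` modulo the common roots
of `T` and the non-minimality axioms of the support of `t`. [Galesi–Lauria 2010, proof of Lemma 2
("`L(t) := R_{T,M_{Sup(t)}}(t)`")] [cite: GalesiLauria2010, Lemma 2] -/
def Lmon (s : ℕ →₀ ℕ) : MvPolynomial ℕ K :=
  residue (locSol G (supp G r (Vtx n s))) (monomial s (1 : K))

variable (K) in
/-- **The operator `L`**, "extended by linearity to any polynomial". [Galesi–Lauria 2010, Lemma 2]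
[cite: GalesiLauria2010, Lemma 2] -/
def L : MvPolynomial ℕ K →ₗ[K] MvPolynomial ℕ K :=
  (basisMonomials ℕ K).constr K (Lmon G r K)

variable {G r}

/-- `L` on a monomial with a coefficient. [Galesi–Lauria 2010, Lemma 2] [cite: GalesiLauria2010, Lemma 2] -/
theorem L_monomial (s : ℕ →₀ ℕ) (a : K) : L G r K (monomial s a) = a • Lmon G r K s := by
  have h1 : L G r K (monomial s (1 : K)) = Lmon G r K s := by
    have := (basisMonomials ℕ K).constr_basis K (Lmon G r K) s
    rwa [coe_basisMonomials] at this
  rw [show monomial s a = a • monomial s (1 : K) by rw [smul_monomial, smul_eq_mul, mul_one],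
    map_smul, h1]

/-- `L` as a sum over monomials. [Galesi–Lauria 2010, Lemma 2] [cite: GalesiLauria2010, Lemma 2] -/
theorem L_eq_sum (p : MvPolynomial ℕ K) :
    L G r K p = ∑ s ∈ p.support, coeff s p • Lmon G r K s := by
  conv_lhs => rw [p.as_sum, map_sum]
  exact Finset.sum_congr rfl fun s _ => L_monomial s _

/-! ### Lemmas 5–7 -/

/-- A polynomial whose vertices lie in `U ∌ u` is fixed by the u-cta ("since `u ∉ Vertex(t)`,
`t|_ρ = t`"). [Galesi–Lauria 2010, proof of Lemma 5] [cite: GalesiLauria2010, Lemma 5] -/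
theorem restrictBy_cta_eq_self {U : Finset (Fin n)} {p : MvPolynomial ℕ K}
    (hp : ∀ s ∈ p.support, Vtx n s ⊆ U) {u : Fin n} (huU : u ∉ U) :
    restrictBy K (cta n u) p = p :=
  restrictBy_eq_self fun s hs j hj => cta_eq_none_iff.2 fun huj =>
    huU (hp s hs (mem_Vtx.2 ⟨j, hj, huj⟩))

/-- **Lemma 5 ⇒ Lemma 6**: for `I ⊇ Sup(U)` with `|I| ≤ r/2` and `Vertex(p) ⊆ U`,
`R_{T,M_I}(p) = R_{T,M_{Sup(U)}}(p)` (superfluous vertices are removed one by one with Lemma 4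
and a u-cta). [Galesi–Lauria 2010, Lemmas 5 and 6] [cite: GalesiLauria2010, Lemma 6] -/
theorem residue_locSol_eq_of_supp_subset {U I : Finset (Fin n)} {p : MvPolynomial ℕ K}
    (hp : ∀ s ∈ p.support, Vtx n s ⊆ U) (hI : supp G r U ⊆ I) (hIr : 2 * I.card ≤ r) :
    residue (locSol G I) p = residue (locSol G (supp G r U)) p := by
  suffices h : ∀ k (I : Finset (Fin n)), (I \ supp G r U).card = k → supp G r U ⊆ I →
      2 * I.card ≤ r → residue (locSol G I) p = residue (locSol G (supp G r U)) p from
    h _ I rfl hI hIr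
  intro k
  induction k using Nat.strong_induction_on with
  | _ k ih =>
    intro I hk hI hIr
    by_cases hIS : I ⊆ supp G r U
    · rw [Finset.Subset.antisymm hIS hI]
    -- Lemma 4: an edge `{u, v}` with `v ∈ I ∖ Sup(U)`, `u ∉ Sup(U) ∪ I ∪ U`
    obtain ⟨u, v, hadj, hvI, hvS, -, huI, huU⟩ := exists_adj_of_not_subset_supp hIr hIS
    -- Lemma 5: `R_{T,M_I}(p) = R_{T,M_{I-{v}}}(p)`
    have step : residue (locSol G I) p = residue (locSol G (I.erase v)) p := by
      refine residue_eq_residue_of_restrictBy (locSol_mono (Finset.erase_subset v I)) (cta n u)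
        fun x hx => ?_
      have hx' : ovr (cta n u) x ∈ locSol G I :=
        ovr_cta_mem_locSol huI (fun w hw hwJ => by
          have : w = v := by
            by_contra hne; exact hwJ (Finset.mem_erase.2 ⟨hne, hw⟩)
          rw [this]; exact hadj) hx
      rw [bval_restrictBy, bval_residue p hx', ← bval_restrictBy, restrictBy_cta_eq_self hp huU]
    rw [step]
    refine ih _ ?_ (I.erase v) rfl (fun w hw => Finset.mem_erase.2
      ⟨fun h => hvS (h ▸ hw), hI hw⟩) ((Nat.mul_le_mul_left 2 (Finset.card_erase_le)).trans hIr)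
    rw [← hk, Finset.erase_sdiff_comm, Finset.card_erase_of_mem (Finset.mem_sdiff.2 ⟨hvI, hvS⟩)]
    exact Nat.sub_lt (Finset.card_pos.2 ⟨v, Finset.mem_sdiff.2 ⟨hvI, hvS⟩⟩) one_pos

/-- **Lemma 7**: `Vertex(R_{T,M_{Sup(U)}}(p)) ⊆ Sup(U) ∪ U` when `Vertex(p) ⊆ U` (a u-cta for a
vertex outside would strictly decrease the residue). [Galesi–Lauria 2010, Lemma 7]
[cite: GalesiLauria2010, Lemma 7] -/
theorem notMem_Vtx_of_mem_support_residue {U : Finset (Fin n)} {p : MvPolynomial ℕ K}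
    (hp : ∀ s ∈ p.support, Vtx n s ⊆ U) {u : Fin n} (huU : u ∉ U) (huS : u ∉ supp G r U)
    {t : ℕ →₀ ℕ} (ht : t ∈ (residue (locSol G (supp G r U)) p).support) : u ∉ Vtx n t := by
  have hfix : restrictBy K (cta n u) (residue (locSol G (supp G r U)) p) =
      residue (locSol G (supp G r U)) p := by
    refine restrictBy_residue_eq (cta n u) fun x hx => ?_
    have hx' : ovr (cta n u) x ∈ locSol G (supp G r U) :=
      ovr_cta_mem_locSol huS (fun w hw hwJ => absurd hw hwJ) hx
    rw [bval_restrictBy, bval_residue p hx', ← bval_restrictBy, restrictBy_cta_eq_self hp huU]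
  intro hu
  obtain ⟨j, hj, huj⟩ := mem_Vtx.1 hu
  have := eq_none_of_mem_support_restrictBy (K := K) (ρ := cta n u)
    (p := residue (locSol G (supp G r U)) p) (t := t) (by rwa [hfix]) hj
  exact (cta_eq_none_iff.1 this) huj

/-- Lemma 7 as an inclusion: `Vertex(R_{T,M_{Sup(U)}}(p)) ⊆ U ∪ Sup(U)`. [Galesi–Lauria 2010,
Lemma 7] [cite: GalesiLauria2010, Lemma 7] -/
theorem Vtx_residue_subset {U : Finset (Fin n)} {p : MvPolynomial ℕ K}
    (hp : ∀ s ∈ p.support, Vtx n s ⊆ U) {t : ℕ →₀ ℕ}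
    (ht : t ∈ (residue (locSol G (supp G r U)) p).support) : Vtx n t ⊆ U ∪ supp G r U := by
  intro u hu
  by_contra h
  rw [Finset.mem_union, not_or] at h
  exact notMem_Vtx_of_mem_support_residue hp h.1 h.2 ht hu

/-! ### Lemma 2: the three requirements -/

/-- **Requirement 1, local form**: a polynomial with `Vertex(p) ⊆ U`, `|U| ≤ cr/2`, vanishing on
the common roots of `T ∪ M_{Sup(U)}`, has `L(p) = 0` (all its monomials are reduced modulo the same
small `I = Sup(U)` by Lemma 6, and `R` is linear). [Galesi–Lauria 2010, proof of Lemma 2,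
Requirement 1] [cite: GalesiLauria2010, Lemma 2] -/
theorem L_eq_zero_of_local {c : ℝ} (hexp : IsVertexExpander G r c) (hc : 0 < c)
    {U : Finset (Fin n)} {p : MvPolynomial ℕ K} (hp : ∀ s ∈ p.support, Vtx n s ⊆ U)
    (hU : (U.card : ℝ) ≤ c * r / 2) (hvan : ∀ x ∈ locSol G (supp G r U), bval x p = 0) :
    L G r K p = 0 := by
  have hIr := two_mul_card_supp_le hexp hc hU
  have h1 : ∀ s ∈ p.support, Lmon G r K s = residue (locSol G (supp G r U)) (monomial s 1) := by
    intro s hs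
    rw [Lmon, ← residue_locSol_eq_of_supp_subset (fun t ht => Vtx_subset_of_mem_support_monomial ht)
      (supp_mono (hp s hs)) hIr]
  rw [L_eq_sum, Finset.sum_congr rfl fun s hs => by rw [h1 s hs, ← residue_smul],
    ← residue_sum]
  have : ∑ s ∈ p.support, coeff s p • (monomial s (1 : K) : MvPolynomial ℕ K) = p := by
    conv_rhs => rw [p.as_sum]
    exact Finset.sum_congr rfl fun s _ => by rw [smul_monomial, smul_eq_mul, mul_one]
  rw [this]
  exact residue_eq_zero_of_vanish hvan

/-- **Requirement 2**: `L(x t) = L(x · L(t))` for a monomial `t` and a variable `x = x_j` with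
`|Vertex(xt)| ≤ cr/2` (GL10: `deg t < cr/4`). [Galesi–Lauria 2010, Lemma 2 (2), proof p. 12–13,
equalities (10)–(21)] [cite: GalesiLauria2010, Lemma 2] -/
theorem L_monomial_add_single {c : ℝ} (hexp : IsVertexExpander G r c) (hc : 0 < c)
    (t : ℕ →₀ ℕ) (j : ℕ) (hsz : ((Vtx n (t + Finsupp.single j 1)).card : ℝ) ≤ c * r / 2) :
    Lmon G r K (t + Finsupp.single j 1) = L G r K (X j * Lmon G r K t) := by
  classical
  set t' := t + Finsupp.single j 1 with ht'
  set U := Vtx n t with hU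
  set U' := Vtx n t' with hU'
  set S := supp G r U with hS
  set S' := supp G r U' with hS'
  have hUU' : U ⊆ U' := Vtx_mono (by rw [ht', support_add_single]; exact Finset.subset_insert _ _)
  have hjU' : vtx n j ⊆ U' := fun u hu => mem_Vtx.2
    ⟨j, (by rw [ht', support_add_single]; exact Finset.mem_insert_self _ _), hu⟩
  have hSS' : S ⊆ S' := supp_mono hUU'
  have hS'r : 2 * S'.card ≤ r := two_mul_card_supp_le hexp hc hsz
  -- the left-hand side: `R_{S'}(x t)`
  rw [Lmon]
  change residue (locSol G S') (monomial t' 1) = _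
  -- the right-hand side, monomial by monomial (equalities (17)–(19))
  set R := Lmon G r K t with hR
  have hRsupp : ∀ s ∈ R.support, Vtx n s ⊆ U ∪ S := fun s hs =>
    Vtx_residue_subset (fun t ht => Vtx_subset_of_mem_support_monomial ht) hs
  have hXR : X j * R = ∑ s ∈ R.support, monomial (s + Finsupp.single j 1) (coeff s R) := by
    conv_lhs => rw [R.as_sum, Finset.mul_sum]
    refine Finset.sum_congr rfl fun s _ => ?_
    rw [X, monomial_mul, one_mul, add_comm]
  have h18 : ∀ s ∈ R.support, Lmon G r K (s + Finsupp.single j 1) =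
      residue (locSol G S') (monomial (s + Finsupp.single j 1) 1) := by
    intro s hs
    have hV : Vtx n (s + Finsupp.single j 1) ⊆ U' ∪ S' := by
      intro u hu
      obtain ⟨i, hi, hui⟩ := mem_Vtx.1 hu
      rw [support_add_single, Finset.mem_insert] at hi
      rcases hi with rfl | hi
      · exact Finset.mem_union_left _ (hjU' hui)
      · rcases Finset.mem_union.1 (hRsupp s hs (mem_Vtx.2 ⟨i, hi, hui⟩)) with h | h
        · exact Finset.mem_union_left _ (hUU' h)
        · exact Finset.mem_union_right _ (hSS' h)
    rw [Lmon, ← residue_locSol_eq_of_supp_subset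
      (fun t ht => Vtx_subset_of_mem_support_monomial ht) (supp_subset_supp_of_subset_union hV) hS'r]
  rw [hXR, map_sum, Finset.sum_congr rfl fun s hs => by
    rw [L_monomial, h18 s hs, ← residue_smul, smul_monomial, smul_eq_mul, mul_one], ← residue_sum,
    ← hXR]
  -- (11)–(13): `R_{S'}(x R_S(t)) = R_{S'}(x R_{S'}(t)) = R_{S'}(x t)`
  have h12 : R = residue (locSol G S') (monomial t 1) := by
    rw [hR, Lmon, ← residue_locSol_eq_of_supp_subset
      (fun t ht => Vtx_subset_of_mem_support_monomial ht) hSS' hS'r]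
  rw [h12, residue_mul_residue, X, monomial_mul, one_mul, add_comm]

/-- **Requirement 3**: `L(1) = 1` ("the support of a constant polynomial is the empty set, so
`L(1) = R_T(1) = 1` since `T` is satisfiable"). [Galesi–Lauria 2010, Lemma 2 (3)]
[cite: GalesiLauria2010, Lemma 2] -/
theorem L_one {c : ℝ} (hexp : IsVertexExpander G r c) (hc : 0 < c) :
    L G r K (1 : MvPolynomial ℕ K) = 1 := by
  rw [show (1 : MvPolynomial ℕ K) = monomial 0 1 from rfl, L_monomial, one_smul, Lmon]
  have : Vtx n (0 : ℕ →₀ ℕ) = ∅ := by simp [Vtx]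
  rw [this, supp_empty hexp hc]
  exact residue_one locSol_empty_nonempty

/-! ### Theorem 1 -/

/-- The product rule, one variable at a time: if `L(g) = 0` and every monomial `t` of `g` has
`|Vertex(x_j t)| ≤ cr/2` then `L(g · x_j) = 0` ("`L(xp) = L(x L(p)) = L(0) = 0`").
[Galesi–Lauria 2010, proof of Theorem 1] [cite: GalesiLauria2010, Theorem 1] -/
theorem L_mul_X_eq_zero {c : ℝ} (hexp : IsVertexExpander G r c) (hc : 0 < c)
    {g : MvPolynomial ℕ K} (hg : L G r K g = 0) {j : ℕ}
    (hsz : ∀ t ∈ g.support, ((Vtx n (t + Finsupp.single j 1)).card : ℝ) ≤ c * r / 2) :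
    L G r K (g * X j) = 0 := by
  have h1 : g * X j = ∑ t ∈ g.support, monomial (t + Finsupp.single j 1) (coeff t g) := by
    conv_lhs => rw [g.as_sum, Finset.sum_mul]
    refine Finset.sum_congr rfl fun t _ => ?_
    rw [X, monomial_mul, mul_one]
  have h2 : X j * L G r K g = ∑ t ∈ g.support, coeff t g • (X j * Lmon G r K t) := by
    rw [L_eq_sum, Finset.mul_sum]
    exact Finset.sum_congr rfl fun t _ => mul_smul_comm _ _ _
  rw [h1, map_sum, Finset.sum_congr rfl fun t ht => by
    rw [L_monomial, L_monomial_add_single hexp hc t j (hsz t ht), ← map_smul], ← map_sum, ← h2, hg,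
    mul_zero, map_zero]

/-- **Theorem 1, the invariant**: every line of a degree-`≤ d` PC derivation from `GOP(G)`,
`d ≤ cr/4`, is mapped to `0` by `L`. [Galesi–Lauria 2010, Theorem 1 ("By induction on the lines
of the proof the last line is mapped to 0")] [cite: GalesiLauria2010, Theorem 1] -/
theorem L_eq_zero_of_derivable {c : ℝ} (hexp : IsVertexExpander G r c) (hc : 0 < c) (hr : 1 ≤ r)
    {d : ℕ} (hd : (d : ℝ) ≤ c * r / 4) {f : MvPolynomial ℕ K}
    (hf : PC.DerivableInDegree (PC.ofCNF K (glGOP G)) d f) : L G r K f = 0 := by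
  classical
  have hcr : 0 ≤ c * r := mul_nonneg hc.le (Nat.cast_nonneg r)
  induction hf with
  | hyp hmem hdeg =>
    obtain ⟨C, hC, rfl⟩ := PC.mem_ofCNF.1 hmem
    rw [PC.totalDegree_ofClause] at hdeg
    rcases List.mem_append.1 hC with hC | hC
    · -- a no-3-cycle axiom: `Vertex ⊆ {a, b, c}`, `3 ≤ d ≤ cr/4`
      obtain ⟨a, b, e, -, -, hCeq⟩ := mem_transClauses.1 hC
      have hlen : C.length = 3 := length_of_mem_transClauses hC
      refine L_eq_zero_of_local hexp hc (U := {a, b, e}) (fun s hs => Vtx_subset_of_transClause hCeq hs)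
        ?_ (fun x hx => bval_ofClause_transClause hC hx)
      have h3 : (3 : ℝ) ≤ d := by exact_mod_cast hlen ▸ hdeg
      have hcard : (({a, b, e} : Finset (Fin n)).card : ℝ) ≤ 3 := by
        exact_mod_cast (Finset.card_insert_le _ _).trans (Nat.succ_le_succ
          ((Finset.card_insert_le _ _).trans (by simp)))
      linarith
    · -- a non-minimality axiom `M_w`: `Vertex ⊆ {w} ∪ Γ(w)`, `c ≤ deg w ≤ d ≤ cr/4`
      obtain ⟨w, -, rfl⟩ := List.mem_map.1 hC
      rw [length_minClause] at hdeg
      have hΓ : outerNeighbors G {w} = G.neighborFinset w := by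
        ext v; rw [mem_outerNeighbors_singleton, SimpleGraph.mem_neighborFinset]
      have hcdeg : c ≤ G.degree w := by
        have := hexp {w} (by simpa using hr)
        rwa [Finset.card_singleton, Nat.cast_one, mul_one, hΓ,
          SimpleGraph.card_neighborFinset_eq_degree] at this
      have hdeg1 : 1 ≤ G.degree w := by
        have : (0 : ℝ) < G.degree w := hc.trans_le hcdeg
        exact_mod_cast this
      have hr4 : (4 : ℝ) ≤ r := by
        by_contra hlt
        have : c * r / 4 < c := by nlinarith
        have : (G.degree w : ℝ) ≤ d := by exact_mod_cast hdeg
        linarith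
      have hr2 : 2 ≤ r := by
        have : (2 : ℝ) ≤ r := by linarith
        exact_mod_cast this
      have hwS : w ∈ supp G r (insert w (G.neighborFinset w)) :=
        mem_supp_of_singleton hr2 (by rw [hΓ]; exact Finset.subset_insert _ _)
      refine L_eq_zero_of_local hexp hc (U := insert w (G.neighborFinset w))
        (fun s hs => Vtx_subset_of_minClause hs) ?_ (fun x hx => bval_ofClause_minClause hwS hx)
      have hcard : ((insert w (G.neighborFinset w)).card : ℝ) ≤ G.degree w + 1 := by
        exact_mod_cast (Finset.card_insert_le _ _).trans
          (by rw [SimpleGraph.card_neighborFinset_eq_degree])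
      have : (G.degree w : ℝ) ≤ d := by exact_mod_cast hdeg
      have : (1 : ℝ) ≤ G.degree w := by exact_mod_cast hdeg1
      linarith
  | booleanAxiom j hdeg =>
    rw [map_sub, X_pow_eq_monomial, show (X j : MvPolynomial ℕ K) = monomial (Finsupp.single j 1) 1
      from rfl, L_monomial, L_monomial, one_smul, one_smul, sub_eq_zero, Lmon, Lmon]
    have hV : Vtx n (Finsupp.single j 2) = Vtx n (Finsupp.single j 1) := by
      rw [Vtx, Vtx, Finsupp.support_single _ two_ne_zero,
        Finsupp.support_single _ one_ne_zero]
    rw [hV]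
    exact residue_congr fun x _ => bval_monomial_eq_of_support_eq x
      (by rw [Finsupp.support_single _ two_ne_zero,
        Finsupp.support_single _ one_ne_zero]) 1
  | add _ _ ih₁ ih₂ => rw [map_add, ih₁, ih₂, add_zero]
  | @mul f h _ hdeg ih =>
    by_cases hf0 : f = 0
    · rw [hf0, zero_mul, map_zero]
    -- `f · h = Σ_u coeff_u(h) · (f · x^u)`; each `f · x^u` is handled variable by variable
    have key : ∀ N (u : ℕ →₀ ℕ) (g : MvPolynomial ℕ K), (u.sum fun _ e => e) = N → g ≠ 0 →
        L G r K g = 0 → (g * monomial u 1).totalDegree ≤ d → L G r K (g * monomial u 1) = 0 := by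
      intro N
      induction N using Nat.strong_induction_on with
      | _ N ihN =>
        intro u g hN hg0 hg hdeg'
        by_cases hu : u = 0
        · rw [hu, show (monomial (0 : ℕ →₀ ℕ) (1 : K)) = 1 from rfl, mul_one]; exact hg
        obtain ⟨i, hi⟩ : ∃ i, i ∈ u.support := by
          by_contra hne
          push Not at hne
          exact hu (Finsupp.support_eq_empty.1 (Finset.eq_empty_of_forall_notMem hne))
        have hui : u i ≠ 0 := Finsupp.mem_support_iff.1 hi
        set u' := u - Finsupp.single i 1 with hu'
        have huu' : u = u' + Finsupp.single i 1 := (Finsupp.sub_add_single_one_cancel hui).symm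
        have hdegu : (u.sum fun _ e => e) = (u'.sum fun _ e => e) + 1 := by
          conv_lhs => rw [huu']
          rw [Finsupp.sum_add_index' (fun _ => rfl) (fun _ _ _ => rfl), Finsupp.sum_single_index rfl]
        have hmon : (monomial u (1 : K) : MvPolynomial ℕ K) = monomial u' 1 * X i := by
          rw [X, monomial_mul, mul_one, ← huu']
        have hg' : g * monomial u' 1 ≠ 0 := mul_ne_zero hg0 (monomial_eq_zero.not.2 one_ne_zero)
        -- degrees: `deg (g x^{u'}) + 1 = deg (g x^u) ≤ d`
        have hdg : (g * monomial u' 1).totalDegree + 1 = (g * monomial u 1).totalDegree := by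
          rw [totalDegree_mul_of_isDomain hg0 (monomial_eq_zero.not.2 one_ne_zero),
            totalDegree_mul_of_isDomain hg0 (monomial_eq_zero.not.2 one_ne_zero),
            totalDegree_monomial _ one_ne_zero, totalDegree_monomial _ one_ne_zero, hdegu, add_assoc]
        have ih' : L G r K (g * monomial u' 1) = 0 :=
          ihN _ (by omega) u' g rfl hg0 hg (by omega)
        rw [hmon, ← mul_assoc]
        refine L_mul_X_eq_zero hexp hc ih' fun t ht => card_Vtx_add_single_le hd ?_ i
        have := le_totalDegree ht
        omega
    have hexpand : f * h = ∑ u ∈ h.support, coeff u h • (f * monomial u 1) := by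
      conv_lhs => rw [h.as_sum, Finset.mul_sum]
      refine Finset.sum_congr rfl fun u _ => ?_
      rw [show monomial u (coeff u h) = coeff u h • (monomial u (1 : K) : MvPolynomial ℕ K) by
        rw [smul_monomial, smul_eq_mul, mul_one], mul_smul_comm]
    rw [hexpand, map_sum]
    refine Finset.sum_eq_zero fun u hu => ?_
    have hh0 : h ≠ 0 := fun h0 => by simp [h0] at hu
    rw [map_smul, key _ u f rfl hf0 ih ?_, smul_zero]
    calc (f * monomial u 1).totalDegree = f.totalDegree + (u.sum fun _ e => e) := by
          rw [totalDegree_mul_of_isDomain hf0 (monomial_eq_zero.not.2 one_ne_zero),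
            totalDegree_monomial _ one_ne_zero]
      _ ≤ f.totalDegree + h.totalDegree := Nat.add_le_add_left (le_totalDegree hu) _
      _ = (f * h).totalDegree := (totalDegree_mul_of_isDomain hf0 hh0).symm
      _ ≤ d := hdeg

/-- **Galesi–Lauria's Theorem 1**: for an `(r, c)`-vertex expander `G` (`r ≥ 1`, `c > 0`) and
`d ≤ cr/4`, `GOP(G)` has no PC refutation of degree `≤ d` over the field `K` ("Apply `L` on all
its lines … the last line (i.e the polynomial 1) is not mapped to 0"). [Galesi–Lauria 2010,
Theorem 1] [cite: GalesiLauria2010, Theorem 1] -/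
theorem not_refutableInDegree_glGOP {c : ℝ} (hexp : IsVertexExpander G r c) (hc : 0 < c)
    (hr : 1 ≤ r) {d : ℕ} (hd : (d : ℝ) ≤ c * r / 4) :
    ¬ PC.RefutableInDegree (PC.ofCNF K (glGOP G)) d := by
  intro h
  have h1 := L_eq_zero_of_derivable (K := K) hexp hc hr hd h
  rw [L_one hexp hc] at h1
  exact one_ne_zero h1

end GOP

/-- **Galesi–Lauria's theorem (ACM ToCL 2010, Thm 1) holds**: the named fact
`GalesiLauria2010_PC_GOP_degree` — for every field, every `(r, c)`-vertex expander `G` with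
`r ≥ 1`, `c > 0` and every `d ≤ cr/4`, the polynomial translation of `GOP(G)` has no PC refutation
of degree `≤ d` — is DISCHARGED by the reproduction of GL10 §2.1, §3 in
`PolynomialCalculusResidue*.lean`, `GraphOrderingPrinciple{Closure,Semantics,DegreeProof}.lean`.
[Galesi–Lauria 2010, Theorem 1] [cite: GalesiLauria2010, Theorem 1] -/
theorem GalesiLauria2010_PC_GOP_degree_holds : GalesiLauria2010_PC_GOP_degree :=
  fun _ _ _ _ _ _ _ hr hc hG _ hd => GOP.not_refutableInDegree_glGOP hG hc hr hd


end Literature.Computability.MetaComplexity
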